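import Summits.Ventures.WeilGRH.ReflectionRungs
import HarnessLib

/-!
# GRH arm (rh-explicit, venture WeilGRH): the reflection rungs at the small moduli `5, 7, 9`

Census-free specialisations of `ReflectionRungs.lean`. For a Dirichlet character `χ` mod `q` the
value `z = χ(2)` satisfies `z^k = χ(2^k) = 1` as soon as `2^k ≡ 1 (mod q)`:
* `q = 5`: `z⁴ = 1`, so `z ≠ 1 ⟹ ‖1 − z‖² ≥ 2` (`z ∈ {i, −1, −i}`) ⟹ `WeilPositivityOnChar χ (2/5)`;
* `q = 7`: `z³ = 1`, so `z ≠ 1 ⟹ ‖1 − z‖² = 3` ⟹ `WeilPositivityOnChar χ ((log 3)/2)`;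
* `q = 9`: `z⁶ = 1`, so `z ≠ 1 ⟹ ‖1 − z‖² ≥ 1` ⟹ `WeilPositivityOnChar χ ((log 3)/2)`.
Since `2` generates `(ℤ/5)ˣ` and `(ℤ/9)ˣ`, `χ(2) ≠ 1` there means exactly `χ ≠ 1` (all four resp. six
nontrivial characters, in particular every primitive one); mod `7` it selects the four characters of
order `3` and `6` (Conrey `7.2, 7.4, 7.3, 7.5`). The two characters mod `7` with `χ(2) = 1` (the
trivial one and the Legendre symbol `7.6`, `(2/7) = +1`) are NOT reached by the reflection transfer at
`(log 3)/2` (criterion value `1.158 > 1`; the cell's certificate for `7.6` uses the parity bonus).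

## References

* A. Weil (1952), (11) and the «lemme» p. 262; H. Yoshida (1992), Thm 1.
-/

noncomputable section

open Complex
open scoped Real ComplexConjugate

namespace Summit.Ventures.WeilGRH

open Literature.NumberTheory.LFunctions

/-! ## Roots of unity of order `3, 4, 6` other than `1` are far from `1` -/

/-- `‖1 − z‖² = (1 − Re z)² + (Im z)²`. [folklore] -/
theorem normSq_one_sub_eq (z : ℂ) : ‖1 - z‖ ^ 2 = (1 - z.re) ^ 2 + z.im ^ 2 := by
  rw [Complex.sq_norm, Complex.normSq_apply]
  simp only [sub_re, one_re, sub_im, one_im, zero_sub]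
  ring

/-- A root of `z² + z + 1` has `‖1 − z‖² = 3`. [folklore] -/
theorem normSq_one_sub_of_sq_add_self_add_one {z : ℂ} (h : z ^ 2 + z + 1 = 0) : ‖1 - z‖ ^ 2 = 3 := by
  have hre := congrArg Complex.re h
  have him := congrArg Complex.im h
  simp only [add_re, one_re, zero_re, add_im, one_im, zero_im, add_zero, sq, mul_re, mul_im] at hre him
  rw [normSq_one_sub_eq]
  have hy : z.im * (2 * z.re + 1) = 0 := by linarith
  rcases mul_eq_zero.1 hy with hy0 | hx
  · rw [hy0] at hre; nlinarith
  · nlinarith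

/-- A root of `z² − z + 1` has `‖1 − z‖² = 1`. [folklore] -/
theorem normSq_one_sub_of_sq_sub_self_add_one {z : ℂ} (h : z ^ 2 - z + 1 = 0) : ‖1 - z‖ ^ 2 = 1 := by
  have hre := congrArg Complex.re h
  have him := congrArg Complex.im h
  simp only [add_re, sub_re, one_re, zero_re, add_im, sub_im, one_im, zero_im, add_zero, sq, mul_re,
    mul_im] at hre him
  rw [normSq_one_sub_eq]
  have hy : z.im * (2 * z.re - 1) = 0 := by linarith
  rcases mul_eq_zero.1 hy with hy0 | hx
  · rw [hy0] at hre; nlinarith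
  · nlinarith

/-- A root of `z² + 1` has `‖1 − z‖² = 2`. [folklore] -/
theorem normSq_one_sub_of_sq_add_one {z : ℂ} (h : z ^ 2 + 1 = 0) : ‖1 - z‖ ^ 2 = 2 := by
  have hre := congrArg Complex.re h
  have him := congrArg Complex.im h
  simp only [add_re, one_re, zero_re, add_im, one_im, zero_im, add_zero, sq, mul_re, mul_im] at hre him
  rw [normSq_one_sub_eq]
  have hy : 2 * (z.re * z.im) = 0 := by linarith
  rcases mul_eq_zero.1 (by linarith : z.re * z.im = 0) with hx0 | hy0
  · rw [hx0] at hre; nlinarith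
  · rw [hy0] at hre; nlinarith

/-- `z³ = 1`, `z ≠ 1` ⟹ `‖1 − z‖² = 3`. [folklore] -/
theorem normSq_one_sub_of_cube_eq_one {z : ℂ} (h3 : z ^ 3 = 1) (h1 : z ≠ 1) : ‖1 - z‖ ^ 2 = 3 := by
  have hf : (z - 1) * (z ^ 2 + z + 1) = 0 := by linear_combination h3
  rcases mul_eq_zero.1 hf with h | h
  · exact absurd (sub_eq_zero.1 h) h1
  · exact normSq_one_sub_of_sq_add_self_add_one h

/-- `z⁴ = 1`, `z ≠ 1` ⟹ `‖1 − z‖² ≥ 2`. [folklore] -/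
theorem two_le_normSq_one_sub_of_pow_four_eq_one {z : ℂ} (h4 : z ^ 4 = 1) (h1 : z ≠ 1) :
    2 ≤ ‖1 - z‖ ^ 2 := by
  have hf : (z - 1) * ((z + 1) * (z ^ 2 + 1)) = 0 := by linear_combination h4
  rcases mul_eq_zero.1 hf with h | h
  · exact absurd (sub_eq_zero.1 h) h1
  rcases mul_eq_zero.1 h with h | h
  · have hz : z = -1 := by linear_combination h
    rw [hz, normSq_one_sub_eq]; norm_num
  · rw [normSq_one_sub_of_sq_add_one h]

/-- `z⁶ = 1`, `z ≠ 1` ⟹ `‖1 − z‖² ≥ 1`. [folklore] -/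
theorem one_le_normSq_one_sub_of_pow_six_eq_one {z : ℂ} (h6 : z ^ 6 = 1) (h1 : z ≠ 1) :
    1 ≤ ‖1 - z‖ ^ 2 := by
  have hf : (z - 1) * ((z + 1) * ((z ^ 2 + z + 1) * (z ^ 2 - z + 1))) = 0 := by
    linear_combination h6
  rcases mul_eq_zero.1 hf with h | h
  · exact absurd (sub_eq_zero.1 h) h1
  rcases mul_eq_zero.1 h with h | h
  · have hz : z = -1 := by linear_combination h
    rw [hz, normSq_one_sub_eq]; norm_num
  rcases mul_eq_zero.1 h with h | h
  · rw [normSq_one_sub_of_sq_add_self_add_one h]; norm_num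
  · rw [normSq_one_sub_of_sq_sub_self_add_one h]

/-! ## The three small moduli -/

/-- **Every Dirichlet character mod `7` with `χ(2) ≠ 1` satisfies `WeilPositivityOnChar χ ((log 3)/2)`**
(`χ(2)³ = χ(8) = χ(1) = 1`, so `‖1 − χ(2)‖² = 3`; these are the four characters of order `3` and `6`).
[cite: Weil1952FormulesExplicites, the «lemme» p. 262; Yoshida1992, Thm 1] -/
theorem weilPositivityOnChar_log_three_half_mod_seven (χ : DirichletCharacter ℂ 7)
    (hχ : χ (2 : ZMod 7) ≠ 1) : WeilPositivityOnChar χ (Real.log 3 / 2) := by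
  have h3 : χ (2 : ZMod 7) ^ 3 = 1 := by
    rw [← map_pow, show ((2 : ZMod 7) ^ 3) = 1 from by decide, map_one]
  exact weilPositivityOnChar_log_three_half_of_ge_seven le_rfl χ
    (normSq_one_sub_of_cube_eq_one h3 hχ).symm.le

/-- **Every Dirichlet character mod `9` with `χ(2) ≠ 1` — i.e. every `χ ≠ 1`, in particular every
primitive character mod `9` — satisfies `WeilPositivityOnChar χ ((log 3)/2)`** (`χ(2)⁶ = χ(64) = 1`,
so `‖1 − χ(2)‖² ≥ 1`). [cite: Weil1952FormulesExplicites, the «lemme» p. 262; Yoshida1992, Thm 1] -/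
theorem weilPositivityOnChar_log_three_half_mod_nine (χ : DirichletCharacter ℂ 9)
    (hχ : χ (2 : ZMod 9) ≠ 1) : WeilPositivityOnChar χ (Real.log 3 / 2) := by
  have h6 : χ (2 : ZMod 9) ^ 6 = 1 := by
    rw [← map_pow, show ((2 : ZMod 9) ^ 6) = 1 from by decide, map_one]
  exact weilPositivityOnChar_log_three_half_of_ge_nine le_rfl χ
    (one_le_normSq_one_sub_of_pow_six_eq_one h6 hχ)

/-- **Every Dirichlet character mod `5` with `χ(2) ≠ 1` — i.e. every `χ ≠ 1`: the three primitive
characters `5.2, 5.3, 5.4` — satisfies `WeilPositivityOnChar χ (2/5)`** (`χ(2)⁴ = χ(16) = 1`, so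
`‖1 − χ(2)‖² ≥ 2`). [cite: Weil1952FormulesExplicites, the «lemme» p. 262; Yoshida1992, §6] -/
theorem weilPositivityOnChar_two_fifths_mod_five (χ : DirichletCharacter ℂ 5)
    (hχ : χ (2 : ZMod 5) ≠ 1) : WeilPositivityOnChar χ (2 / 5) := by
  have h4 : χ (2 : ZMod 5) ^ 4 = 1 := by
    rw [← map_pow, show ((2 : ZMod 5) ^ 4) = 1 from by decide, map_one]
  exact weilPositivityOnChar_two_fifths_of_ge_five le_rfl χ
    (two_le_normSq_one_sub_of_pow_four_eq_one h4 hχ)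

end Summit.Ventures.WeilGRH
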